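import Summits.CriticalPhenomena.PercolationContinuityZ3.Theorems.Transplant.SkelNeg1ParamsLO
import Summits.CriticalPhenomena.PercolationContinuityZ3.Theorems.Transplant.SkelPhiConcScheduleN
import Summits.CriticalPhenomena.PercolationContinuityZ3.Theorems.Transplant.SkelNeg1ChoiceO
import HarnessLib

/-!
# N1 params, part 4: THE CHOICE FUNCTION OF THE {±1} NODE with its two open slots explicit — `PlanarSkeletonNeg.negChoiceAllOF fv Sv : ChoiceFnNO`
# (`fv` = the width-clearance slot `f` of `Neg.nL`, `Sv` = the q-level fibre block `SchedIn`), the fibre schedule of record `Neg.schedOf` (column slot = `Nrep (cen x) + 1`),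
# the scheme of record `Neg.ΓO/FDO/LDO` (hp-8's `cellGeomSG₂/faceDataSG/levelDataS` over the ORIENTED fine map `Neg.fineO` and the cells `Neg.fcells`), the bridge
# `eventO = eventN (oriφ …) (orient …)`, the unpacking of `AtQO` at the two pairs, and **`geomHoldsNOFn_negChoiceAllOF : ∀ fv Sv, GeomHoldsNOFn (negChoiceAllOF fv Sv)`**

builds on p205010 (kernel theorem, internal audit signed; external expert review pending) — nothing in this file uses p205010; NOTHING is claimed about
the node `SamePDropOfSkeletonNeg₁` (OPEN): this file discharges ONE of the four obligations of `samePDropOfSkeletonNeg₁_of_choiceFnNO` (the geometric one) for the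
choices of record; (R)/(F)/(C) are the residue seats'.
Status sentence (coordinator 2026-08-20T04:30Z): "θ(p_c) = 0 on ℤ^d, all d ≥ 2 — kernel-verified (Lean 4/Mathlib, standard axioms); internal adversarial
audit SIGNED 2026-08-20 04:29Z; external expert review pending."
Lane `prim-bschramm-*`, seat `prim-bschramm-stmt` (gen 13); helper file (`--supports stmt-CriticalPhenomena-4575 --as helper`); ledger HOME/prim-bschramm-stmt/NEG-PARAMS.md v0.8;
interface of record = p3-g8's `ChoiceNO` (SkelNeg1ChoiceO p282003; lead g6 14:23:27Z/14:38:25Z).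
THE TWO SLOTS (why parameters, not values): the width clearance `f` of the long pair (NEG-PARAMS (n5)(v)(vi): `d₀+q+3R′+1`, `C_run·R′` — numbers owed by the (R)/run records)
and the q-level fibre inputs `SchedIn` ((n10): `rmax := rmaxφ`, `u`, `M`, `ψM`, `ψtop`, `reachK`, `Rex` — owed by the (C)/(F) binder lists) are not all posted; every value
and fact below holds for EVERY `fv : FSlot`, `Sv : SSlot`, so the residue theorems are stated against `negChoiceAllOF fv Sv` with their floor hypotheses on `fv`/`Sv`,
and the node file instantiates `negChoiceAllO := negChoiceAllOF Neg.fR Neg.SR` once the ledger closes the slots (two one-line definitions + the floor lemmas).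
* §1 `OutO.merged` (the merged record of an oriented output), `FactsO.shared/clauses`, the bridge **`eventO_some_eq_eventN_orient`** / `eventO_none_eq_eventN`;
* §2 `Neg.FSlot/SSlot`, `Neg.offN` (column slot of record), **`Neg.schedOf`** (`Prm.schedN S fcells offN`), `schedOf_WFS2`, `colQ_schedOf`, `Neg.fOf`, **`Neg.ΓO/FDO/LDO`**,
  **`Neg.choiceAtOF`**, **`negChoiceAllOF`**, `negChoiceAllOF_eq`;
* §3 unpacking `AtQO` for the choices of record: `factsO_of_atQO`, `eqNumL_of_atQO`, `clauseL/S_of_atQO`, **`inputsS_of_atQO`** / **`inputsL_of_atQO`** (the eight piece-links of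
  the two pairs at the ORIENTED maps `φS`/`φL` over the merged record, accuracy `Neg.δI`), `zone_of_atQO`;
* §4 **`geomHoldsNOFn_negChoiceAllOF`**.
[cite: KozmaNitzan2024, §4 Theorem 6 (pp. 25–31): the order of constants; pp. 25–27] [cite: MartineauTassion2017, §3.2 Lemma 3.5, §4.3]
-/

noncomputable section

open scoped Classical

namespace Summit.CriticalPhenomena.PercolationContinuityZ3.Theorems.Transplant

open MeasureTheory Literature.Probability.Percolation Literature.Probability.LatticeModels SimpleGraph KNCells
open Literature.Barriers.CriticalPhenomena (HasExponentialGrowth)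

/-! ## §1 The merged record of an oriented output; the event bridge -/

namespace Skelφ.StepI

variable {V : Type} {G : SimpleGraph V}

/-- **The merged Step-I″ record of the oriented output** `O = (D, DT, ori)`: `O.D.orient O.DT O.ori`. [this work] -/
abbrev OutO.merged (O : OutO V) : DataN V := O.D.orient O.DT O.ori

variable [G.LocallyFinite]

/-- The shared fields out of `FactsO`. [folklore] -/
theorem OutO.FactsO.shared [Countable V] {φ : V → Site 2} {types : Finset V} {hfr : Frames G φ types} {p : unitInterval} {hC : CylSubcritical G φ types p}
    {m₀ : ℕ} {t : V} {O : OutO V} (h : O.FactsO hfr hC m₀ t) : O.DT.Λ = O.D.Λ ∧ O.DT.k = O.D.k ∧ O.DT.R = O.D.R ∧ O.DT.M₀ = O.D.M₀ ∧ O.DT.n₁ = O.D.n₁ :=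
  ⟨h.2.2.2.2.2.1, h.2.2.2.2.2.2.1, h.2.2.2.2.2.2.2.1, h.2.2.2.2.2.2.2.2.1, h.2.2.2.2.2.2.2.2.2.1⟩

/-- The oriented clauses out of `FactsO`. [folklore] -/
theorem OutO.FactsO.clauses [Countable V] {φ : V → Site 2} {types : Finset V} {hfr : Frames G φ types} {p : unitInterval} {hC : CylSubcritical G φ types p}
    {m₀ : ℕ} {t : V} {O : OutO V} (h : O.FactsO hfr hC m₀ t) :
    ∀ M, O.D.M₀ ≤ M → ∀ n, O.D.n₁ M ≤ n →
      (O.ori t M n = true → O.D.EqGeom G φ t M n ∧ (O.D.hgt t M n).natAbs ≤ 10 * n) ∧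
      (O.ori t M n = false → O.DT.EqGeom G (trφ φ) t M n ∧ (O.DT.hgt t M n).natAbs ≤ 10 * n) :=
  h.2.2.2.2.2.2.2.2.2.2

/-- The seed-level facts out of `FactsO` (at the merged record: same `k`, `M₀`). [folklore] -/
theorem OutO.FactsO.seed [Countable V] {φ : V → Site 2} {types : Finset V} {hfr : Frames G φ types} {p : unitInterval} {hC : CylSubcritical G φ types p}
    {m₀ : ℕ} {t : V} {O : OutO V} (h : O.FactsO hfr hC m₀ t) : m₀ ≤ O.merged.k ∧ 1 ≤ O.merged.k ∧ O.merged.k ≤ O.merged.M₀ ∧ O.merged.R = fatRadius hfr hC ∧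
      O.merged.Λ = fatSeq hfr hC :=
  ⟨h.1, h.2.1, h.2.2.1, h.2.2.2.1, h.2.2.2.2.1⟩

/-- **BRIDGE (zones)**: the oriented zone input is the merged record's zone input (any map). [folklore] -/
theorem eventO_none_eq_eventN (φ ψ : V → Site 2) (D DT : DataN V) (ori : V → ℕ → ℕ → Bool) (t : V) (M : ℕ) :
    eventO G φ D DT ori (t, M, none) = eventN G ψ (D.orient DT ori) (t, M, none) := rfl

/-- **BRIDGE (piece-links)**: the oriented input at `(t, M, n)` is the merged record's input for the ORIENTED MAP `oriφ φ (ori t M n)` (shared `Λ, k, R`). [this work] -/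
theorem eventO_some_eq_eventN_orient (φ : V → Site 2) {D DT : DataN V} {ori : V → ℕ → ℕ → Bool} (hΛ : DT.Λ = D.Λ) (hk : DT.k = D.k) (hR : DT.R = D.R)
    (t : V) (M n : ℕ) (fam : Fin 2) (σ τ : ℤˣ) :
    eventO G φ D DT ori (t, M, some (n, fam, σ, τ)) = eventN G (oriφ φ (ori t M n)) (D.orient DT ori) (t, M, some (n, fam, σ, τ)) := by
  cases hb : ori t M n
  · simp only [eventO_some, hb, Bool.false_eq_true, ↓reduceIte, oriφ_false]
    exact (eventN_orient_some_false hb hΛ hk hR (trφ φ) fam σ τ).symm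
  · simp only [eventO_some, hb, ↓reduceIte, oriφ_true]
    exact (eventN_orient_some_true hb φ fam σ τ).symm

end Skelφ.StepI

namespace PlanarSkeletonNeg

open SkelConc (Consts)
open BoxProdZ2 (ConcRadiiG)
open Skelφ (oriφ trφ)
open Skelφ.StepI (DataN OutO)

/-! ## §2 The slots, the schedule of record, the scheme of record, the choice function -/

namespace Neg

/-- **A width-slot**: the value of the clearance floor `f` of `Neg.nL` as a function of everything p-fixed (constants, skeleton, base vertex, density, merged record). [this work] -/
def FSlot : Type 1 :=
  ∀ (κ : Consts) {V : Type} [DecidableEq V] [Countable V] {G : SimpleGraph V} [G.LocallyFinite], PlanarSkeletonNeg G → V → unitInterval → DataN V → ℕ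

/-- **A schedule-input slot**: the q-level fibre block `SchedIn` as a function of the p-fixed data, the width clearance and the running density. [this work] -/
def SSlot : Type 1 :=
  ∀ (κ : Consts) {V : Type} [DecidableEq V] [Countable V] {G : SimpleGraph V} [G.LocallyFinite],
    PlanarSkeletonNeg G → V → unitInterval → DataN V → ℕ → unitInterval → Skelφ.Prm.SchedIn

section Values

variable (κ : Consts) {V : Type} [DecidableEq V] [Countable V] {G : SimpleGraph V} [G.LocallyFinite] (Φ : PlanarSkeletonNeg G) (t : V)
  (p : unitInterval) (D : DataN V) (f : ℕ)

/-- **The column slot of record**: `offN w := Nrep (cen w) + 1` (the radius at which the fine map's column point of the macro-cell `w` is in the window span). [this work] -/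
def offN : Site 2 → ℕ := fun w => Nrep κ Φ t p D f ((fcells κ Φ t p D f).cen w) + 1

/-- **THE FIBRE SCHEDULE OF RECORD of N1** from the q-level inputs `S`: `Prm.schedN S fcells offN`. [cite: KozmaNitzan2024, §4 pp. 25–26; Lemma 12 (p. 24)] -/
def schedOf (S : Skelφ.Prm.SchedIn) : ConcRadiiG := Skelφ.Prm.schedN S (fcells κ Φ t p D f) (offN κ Φ t p D f)

/-- `schedOf` by name. [folklore] -/
theorem schedOf_eq (S : Skelφ.Prm.SchedIn) : schedOf κ Φ t p D f S = Skelφ.Prm.schedN S (fcells κ Φ t p D f) (offN κ Φ t p D f) := rfl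

/-- **`WFS2 fcells (schedOf S)`** for every input block. [this work] -/
theorem schedOf_WFS2 (S : Skelφ.Prm.SchedIn) : Skelφ.WFS2 (fcells κ Φ t p D f) (schedOf κ Φ t p D f S) := Skelφ.Prm.schedN_WFS2 _ _ _

/-- **The column floor of the schedule of record**: `Nrep (cen x) + 1 ≤ rQ a x` at every `(a, x)`. [this work] -/
theorem colQ_schedOf (S : Skelφ.Prm.SchedIn) : ∀ a x, Nrep κ Φ t p D f ((fcells κ Φ t p D f).cen x) + 1 ≤ (schedOf κ Φ t p D f S).rQ a x :=
  fun a x => Skelφ.Prm.off_le_schedN_rQ S (fcells κ Φ t p D f) (offN κ Φ t p D f) a x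

variable (O : OutO V) (fv : FSlot) (Sv : SSlot) (q : unitInterval)

/-- The width clearance AT the oriented output: `fv` at the merged record. [this work] -/
def fOf : ℕ := fv κ Φ t p O.merged

/-- **THE ANCHORED-CELLS SCHEME OF RECORD at `(O, q)`**: hp-8's `cellGeomSG₂` over the oriented fine map `fineO`, the cells `fcells`, root `t`, schedule `schedOf (Sv …)`.
[cite: KozmaNitzan2024, §4 pp. 25–27 (Q_v, M_v, E_{v,x}, H^j_{v,x})] -/
def ΓO : CellGeom V ℕ :=
  Skelφ.cellGeomSG₂ G (fineO κ Φ t p O.D O.DT O.ori (fOf κ Φ t p O fv)) (fcells κ Φ t p O.merged (fOf κ Φ t p O fv)) t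
    (schedOf κ Φ t p O.merged (fOf κ Φ t p O fv) (Sv κ Φ t p O.merged (fOf κ Φ t p O fv) q))

/-- **The face data of record at `(O, q)`** (`faceDataSG`). [this work] -/
def FDO : FaceData V ℕ :=
  Skelφ.faceDataSG G (fineO κ Φ t p O.D O.DT O.ori (fOf κ Φ t p O fv)) (fcells κ Φ t p O.merged (fOf κ Φ t p O fv)) t
    (schedOf κ Φ t p O.merged (fOf κ Φ t p O fv) (Sv κ Φ t p O.merged (fOf κ Φ t p O fv) q))

/-- **The level data of record at `O`** (`levelDataS`; density-free). [this work] -/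
def LDO : LevelData V ℕ := Skelφ.levelDataS (fineO κ Φ t p O.D O.DT O.ori (fOf κ Φ t p O fv)) (fcells κ Φ t p O.merged (fOf κ Φ t p O fv))

variable (hC : Φ.CylSubcritical p)

/-- **THE N1 CHOICES OF RECORD at `(κ, Φ, t, p)` with the two slots**: `δI := Neg.δI`, `m₀ := 1`, `Sz := {M_u}`, `SMn := {(M_u, n_s), (M_L, n_L f)}` at the merged record,
`Γ/FD/LD := ΓO/FDO/LDO`, admissibility from `Sz_adm`/`SMn_adm_at`. [cite: KozmaNitzan2024, §4 Theorem 6 (pp. 25–31)] -/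
def choiceAtOF : ChoiceNO κ Φ t p hC where
  δI := Neg.δI κ Φ
  m₀ := Neg.m₀
  Sz := fun O => Neg.Sz O.merged
  SMn := fun O => Neg.SMn κ Φ t p O.merged (fOf κ Φ t p O fv)
  Γ := fun O q => ΓO κ Φ t p O fv Sv q
  FD := fun O q => FDO κ Φ t p O fv Sv q
  LD := fun O _ => LDO κ Φ t p O fv
  δI_pos := Neg.δI_pos κ Φ
  δI_lt_one := Neg.δI_lt_one κ Φ
  S_adm := fun O _ => ⟨Neg.Sz_adm O.merged, Neg.SMn_adm_at κ Φ t p O.merged _⟩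

end Values

end Neg

/-- **THE CHOICE FUNCTION OF THE {±1} NODE with the two slots explicit**: `negChoiceAllOF fv Sv κ G Φ … t … p … hC := Neg.choiceAtOF κ Φ t p fv Sv hC`.
[cite: KozmaNitzan2024, §4 Theorem 6 (pp. 25–31)] -/
def negChoiceAllOF (fv : Neg.FSlot) (Sv : Neg.SSlot) : ChoiceFnNO :=
  fun κ _ _ _ _ _ Φ _ t _ _ p _ _ hC => Neg.choiceAtOF κ Φ t p fv Sv hC

/-- `negChoiceAllOF` unfolds to `Neg.choiceAtOF` (by `rfl`). [folklore] -/
theorem negChoiceAllOF_eq (fv : Neg.FSlot) (Sv : Neg.SSlot) (κ : Consts) {V : Type} [DecidableEq V] [Countable V] (G : SimpleGraph V) [G.LocallyFinite]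
    (Φ : PlanarSkeletonNeg G) (hg : ¬ HasExponentialGrowth G) (t : V) (ht : t ∈ Φ.types) (h1 : Φ.types = {t}) (p : unitInterval) (hp0 : 0 < (p : ℝ))
    (hp1 : (p : ℝ) < 1) (hC : Φ.CylSubcritical p) : negChoiceAllOF fv Sv κ G Φ hg t ht h1 p hp0 hp1 hC = Neg.choiceAtOF κ Φ t p fv Sv hC := rfl

/-! ## §3 Unpacking `AtQO` for the choices of record -/

namespace Neg

section AtQ

variable {κ : Consts} {V : Type} [DecidableEq V] [Countable V] {G : SimpleGraph V} [G.LocallyFinite] {Φ : PlanarSkeletonNeg G} {t : V} {p : unitInterval}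
  {hC : Φ.CylSubcritical p} {fv : FSlot} {Sv : SSlot} {O : OutO V} {q : unitInterval}

/-- `FactsO`, the density window and Φ2 at `q` out of `AtQO`. [folklore] -/
theorem factsO_of_atQO (hAt : (choiceAtOF κ Φ t p fv Sv hC).AtQO O q) :
    O.FactsO Φ.frame hC Neg.m₀ t ∧ (p : ℝ) / 2 ≤ q ∧ (q : ℝ) ≤ p ∧ Φ.CylSubcritical q := ⟨hAt.1, hAt.2.1, hAt.2.2.1, hAt.2.2.2.2⟩

/-- **The numeric long clause at the merged record** out of `AtQO`. [this work] -/
theorem eqNumL_of_atQO (hAt : (choiceAtOF κ Φ t p fv Sv hC).AtQO O q) : EqNumL κ Φ t p O.merged (fOf κ Φ t p O fv) :=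
  eqNumL_of_factsO κ Φ t p O.D O.DT O.ori _ hAt.1.shared.2.2.1 hAt.1.clauses

/-- **The long clause (oriented map `φL`, shear bound `|h_L| ≤ 10 n_L`)** out of `AtQO`. [this work] -/
theorem clauseL_of_atQO (hAt : (choiceAtOF κ Φ t p fv Sv hC).AtQO O q) :
    O.merged.EqGeom G (φL κ Φ t p O.D O.DT O.ori (fOf κ Φ t p O fv)) t (ML κ Φ t p O.merged) (nL κ Φ t p O.merged (fOf κ Φ t p O fv)) ∧
      (hL κ Φ t p O.merged (fOf κ Φ t p O fv)).natAbs ≤ 10 * nL κ Φ t p O.merged (fOf κ Φ t p O fv) :=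
  clauseL_of_factsO κ Φ t p O.D O.DT O.ori _ hAt.1.shared.2.2.1 hAt.1.clauses

/-- **The short clause (oriented map `φS`, `|h_s| ≤ 10 n_s`)** out of `AtQO`. [this work] -/
theorem clauseS_of_atQO (hAt : (choiceAtOF κ Φ t p fv Sv hC).AtQO O q) :
    O.merged.EqGeom G (φS t O.D O.DT O.ori (Φ := Φ)) t (Mu O.merged) (nS O.merged) ∧ (hS t O.merged).natAbs ≤ 10 * nS O.merged :=
  clauseS_of_factsO Φ t O.D O.DT O.ori hAt.1.shared.2.2.1 hAt.1.clauses

/-- **THE SHORT PAIR'S EIGHT PIECE-LINKS at `q`** (kit routes), for the oriented map `φS` over the merged record, accuracy `δI`. [this work] -/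
theorem inputsS_of_atQO (hAt : (choiceAtOF κ Φ t p fv Sv hC).AtQO O q) (fam : Fin 2) (σ τ : ℤˣ) :
    1 - Neg.δI κ Φ <
      (bondPercolation G q).real (Skelφ.StepI.eventN G (φS t O.D O.DT O.ori (Φ := Φ)) O.merged (t, Mu O.merged, some (nS O.merged, fam, σ, τ))) := by
  obtain ⟨hΛ, hk, hR, -, -⟩ := hAt.1.shared
  have ht : t ∈ ({t} : Finset V) := Finset.mem_singleton_self t
  have hmem := Skelφ.StepI.mem_indexNP_some (Sz := Neg.Sz O.merged) ht (mem_SMn κ Φ t p O.merged (fOf κ Φ t p O fv)).1 fam σ τ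
  have h := hAt.2.2.2.1 _ hmem
  rwa [Skelφ.StepI.eventO_some_eq_eventN_orient Φ.φ hΛ hk hR] at h

/-- **THE LONG PAIR'S EIGHT PIECE-LINKS at `q`** (strides, faces, corridors), for the oriented map `φL` over the merged record, accuracy `δI`. [this work] -/
theorem inputsL_of_atQO (hAt : (choiceAtOF κ Φ t p fv Sv hC).AtQO O q) (fam : Fin 2) (σ τ : ℤˣ) :
    1 - Neg.δI κ Φ <
      (bondPercolation G q).real (Skelφ.StepI.eventN G (φL κ Φ t p O.D O.DT O.ori (fOf κ Φ t p O fv)) O.merged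
        (t, ML κ Φ t p O.merged, some (nL κ Φ t p O.merged (fOf κ Φ t p O fv), fam, σ, τ))) := by
  obtain ⟨hΛ, hk, hR, -, -⟩ := hAt.1.shared
  have ht : t ∈ ({t} : Finset V) := Finset.mem_singleton_self t
  have hmem := Skelφ.StepI.mem_indexNP_some (Sz := Neg.Sz O.merged) ht (mem_SMn κ Φ t p O.merged (fOf κ Φ t p O fv)).2 fam σ τ
  have h := hAt.2.2.2.1 _ hmem
  rwa [Skelφ.StepI.eventO_some_eq_eventN_orient Φ.φ hΛ hk hR] at h

/-- **THE UNIQUENESS ZONE at scale `M_u` at `q`**, accuracy `δI` — as the merged record's zone input (`eventN … (t, M_u, none)`, any map; `= UniqZone.zone G (O.D.Λ t) O.D.k M_u`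
by `eventN_none`). [this work] -/
theorem zone_of_atQO (hAt : (choiceAtOF κ Φ t p fv Sv hC).AtQO O q) :
    1 - Neg.δI κ Φ < (bondPercolation G q).real (Skelφ.StepI.eventN G (φS t O.D O.DT O.ori (Φ := Φ)) O.merged (t, Mu O.merged, none)) := by
  have ht : t ∈ ({t} : Finset V) := Finset.mem_singleton_self t
  have hmem := Skelφ.StepI.mem_indexNP_none (SMn := Neg.SMn κ Φ t p O.merged (fOf κ Φ t p O fv)) ht (Mu_mem_Sz O.merged)
  have h := hAt.2.2.2.1 _ hmem
  rw [Skelφ.StepI.eventO_none_eq_eventN Φ.φ (φS t O.D O.DT O.ori (Φ := Φ))] at h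
  exact h

end AtQ

end Neg

/-! ## §4 The geometric obligation of the choices of record -/

/-- **`GeomHoldsNOFn (negChoiceAllOF fv Sv)` FOR EVERY PAIR OF SLOTS**: root, `K₀ ≤ K`, `RunGeom`, `AnchGeom`, `SepGeom₂`, `ExitGeom`, `StepsGeom`, `LevelGeom` of the scheme of
record — hp-8 g33's records over the non-step fine map (`SkelPhiCellsWeakG(Levels)`, `TwoAxisParaCellsFineRep`) with this column's `hψ0/hlip/hws/hcol`, the schedule's `WFS2`
and column floor by construction. [cite: KozmaNitzan2024, §4 pp. 25–29] -/
theorem geomHoldsNOFn_negChoiceAllOF (fv : Neg.FSlot) (Sv : Neg.SSlot) : GeomHoldsNOFn (negChoiceAllOF fv Sv) := by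
  intro κ V _ _ G _ Φ hg t ht h1 p hp0 hp1 hC O q hAt
  obtain ⟨-, -, hR, -, -⟩ := hAt.1.shared
  obtain ⟨h1', h2, -, h4, h5, h6, h7, h8, h9⟩ := Neg.geom_fineO_of_factsO κ Φ t p O.D O.DT O.ori (Neg.fOf κ Φ t p O fv) hR hAt.1.clauses
    (Neg.schedOf_WFS2 κ Φ t p O.merged (Neg.fOf κ Φ t p O fv) (Sv κ Φ t p O.merged (Neg.fOf κ Φ t p O fv) q))
    (Neg.colQ_schedOf κ Φ t p O.merged (Neg.fOf κ Φ t p O fv) (Sv κ Φ t p O.merged (Neg.fOf κ Φ t p O fv) q))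
  exact ⟨h1', h2, h4, h5, h6, h7, h8, h9⟩

end PlanarSkeletonNeg

end Summit.CriticalPhenomena.PercolationContinuityZ3.Theorems.Transplant

end
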